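import Literature.NumberTheory.EllipticCurves.LevelLoweringPrimesCount
import Literature.NumberTheory.DiophantineGeometry.PastenValuationProductsProofs
import Literature.Barriers.ABC.EpsilonCannotBeDroppedHolds
import HarnessLib

/-!
# R-H ROUND 4, O-82 «log-menu-admissibility», support lemma (L): the least prime outside Pasten's
# level-lowering set `L(E) ∪ {p ∣ N_E}` is `O(log N_E)` — typed and PROVED (KEY «R4O82-LEMMAL», count-neutral)

abc-iut cell, rung LADDER-ABC:A2.RESCUE.H; seat abc-iut-rh4-id-8 g1 (planner; KEY
`wake/KEY-abc-iut-rh4-id-8-R4O82-LEMMAL.md`, director-abc g6 2026-08-27T17:58:37Z, desk RULING R113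
«optional count-neutral typing: O-82 lemma (L) support-grade»). Card of record
`plan/rescue/R-H/ROUND4/IDEAS/card-log-menu-admissibility.md` ade808733e0f4d2a (§0 (L), §5 residual
`logMenuAdmissible_of_pasten`), critic file `crit-log-menu-admissibility-abc-iut-rh4-crit-4.md`
e7a5f344f7b6b9a2 (WORD ANNEX; F2: (L) is the θ-form VARIANT of Pasten's Cor 16.6). PROOF-ONLY file:
no `def`, no new `Prop` fact (FROZEN FACT-LIST f75a60bac22efdb6 respected), no instance / notation.

## The printed source of the inequality shape

H. Pasten, *Shimura curves and the abc conjecture*, J. Number Theory **254** (2024) 214–335 =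
arXiv:1705.09251 (held TeX text; arXiv numbering as in `LevelLoweringPrimesCount.lean`: §1.4 p. 8, §16.3
pp. 50–51), §16.3 **Corollary 16.6** (Counting level-lowering primes): with
`L(E) := {ℓ prime : ∃ p ∣ N_E, ℓ ∣ v_p(Δ_E)}`, "for all semi-stable elliptic curves `E` over `ℚ` we
have `#L(E) < (11/2 + ε) log N_E / log log N_E + O_ε(1)`", PROOF: "Let `Λ(E)` be the product of the
primes in `L(E)`. Then `Λ(E)` divides `∏_{p∣N_E} v_p(Δ_E)` and the previous theorem [Thm 16.5 =
Thm 1.12] gives `Λ(E) ≪_ε N_E^{11/2+ε}`. … the result now follows from the prime number theorem."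
In the tree: the set `WeierstrassCurve.levelLoweringPrimes` and `prod_levelLoweringPrimes_dvd`
(PROVED), the named facts `Literature.NumberTheory.EllipticCurves.PastenShimura2024_cor_16_6`
(COUNTING form, reduced to Thm 1.12 in `LevelLoweringPrimesCountProofs`) and
`Literature.NumberTheory.DiophantineGeometry.pasten_valuationProduct_semistable` (Thm 1.12, the
hypothesis `h` below; `↔ pastenShimura2024_thm_1_12` by
`pasten_valuationProduct_semistable_iff_pastenShimura2024_thm_1_12`) — cited BY NAME, nothing restated.

## What is proved here (the card's lemma (L), its LEAST-PRIME / θ-form of the same divisibility)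

* `exists_prime_not_dvd_le_of_log_lt_theta` — sieve step: if `log M < ϑ(X)` then some prime `l ≤ X`
  does not divide `M` (else `X# ∣ M`, `ϑ(X) = log X#`, Mathlib `Chebyshev.theta_eq_log_primorial`).
  (Nearest tree lemmas, different statements, not restated: the residue form
  `Literature.Barriers.Parity.NoSmallPrimeValues.exists_prime_not_dvd_sub` and the unbounded
  `Literature.AlgebraicGeometry.DuqueFrancoVillaflor2023.exists_prime_not_dvd_two_mul`.)
* `exists_prime_not_dvd_le_log` — the least prime not dividing `M ≥ 1` is `≤ (1 + ε) log M + C_ε`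
  (prime number theorem `ϑ(x) ~ x`, tree `Literature.NumberTheory.LFunctions.chebyshevTheta_isEquivalent`
  through `Literature.Barriers.ABC.StewartTijdeman.eventually_theta_ge`, cited by name).
* `exists_admissiblePrime_le_log_conductor` — **lemma (L)**: assuming Pasten's Thm 1.12
  (`h : pasten_valuationProduct_semistable`), for every `ε > 0` there is `c₂` such that every
  semistable elliptic `W/ℚ` has a prime `l ≥ 11` with `l ∤ N_E`, `l ∤ v_p(Δ_E)` for every `p ∣ N_E`
  (i.e. `l ∉ L(E)`: `not_mem_levelLoweringPrimes_of_forall_not_dvd`), and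
  `l ≤ (13/2 + ε)·log N_E + c₂` — apply the previous lemma to `M = 210 · N_E · ∏_{p∣N_E} v_p(Δ_E)`,
  `log M ≤ (13/2 + ε/2) log N_E + log(210 K_{ε/2})`. The card states the Chebyshev-strength constant
  `(13/2 + ε)/log 2 ≈ 9.38`; with `ϑ(x) ~ x` in the tree the constant is `13/2 + ε`, and the card's
  literal residual is the corollary `logMenuAdmissible_of_pasten` (since `log 2 ≤ 1`).

READING (cell side, not used in any proof here): `l ∤ N_E ∧ ∀ p ∣ N_E, l ∤ v_p(Δ_E)` with `l ≥ 11` is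
the semistable-`E/ℚ` content of the [IUTchI] Def 3.1 (c) admissibility clause «`l` prime to the
residue characteristics of `V^bad_mod` and to the orders of the `q`-parameters» as typed in the cell
(`Literature.IUT.LogVolume.Cor22.CondP2`; the fields `l_ne_residueChar` / `l_coprime_qParamOrd` of
`Literature.IUT.HodgeTheaters.InitialThetaData`); what the bound does
or does not buy the annexed doors O-01…O-05 is the card's §0 (D)/(F) and the critic's §2 — RECORD /
ANNEX, no rung (D-0138). HONEST FRAMING: a classical lemma about elliptic curves over `ℚ`, conditional
on one NAMED printed theorem used as a hypothesis (typed ≠ proved for `h`); nothing here asserts that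
Θ-data exist, that [IUTchIII] Cor 3.12 holds, or that abc is proved or refuted; no side is taken on
any author (D-0045); A-PS is NOT abc. COUNT-NEUTRAL: documents census row O-82 only.

## References

* [PastenShimura2024] H. Pasten, J. Number Theory 254 (2024) = arXiv:1705.09251: Thm 1.12, Thm 1.13,
  §16.3 Thm 16.5 and Cor 16.6 (arXiv pp. 50–51).
* [MontgomeryVaughan2007] H. L. Montgomery, R. C. Vaughan, *Multiplicative Number Theory I*, §8.1
  eq. (8.3) (`ϑ(x) ∼ x`).
-/

noncomputable section

open Filter
open Literature.NumberTheory.DiophantineGeometry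

namespace Summit.ABC.IUTFork.Repair.RH.LogMenuAdmissible

/-! ## §1. The sieve step and the least prime not dividing `M` -/

/-- **Sieve step.** If `log M < ϑ(X)` for naturals `M ≠ 0` and `X`, some prime `l ≤ X` does not
divide `M`: otherwise every prime `≤ X` divides `M`, so the primorial `X#` divides `M` and
`ϑ(X) = log X# ≤ log M` (Mathlib `Chebyshev.theta_eq_log_primorial`). [folklore] -/
theorem exists_prime_not_dvd_le_of_log_lt_theta {M X : ℕ} (hM : M ≠ 0)
    (h : Real.log M < Chebyshev.theta X) : ∃ l : ℕ, l.Prime ∧ l ≤ X ∧ ¬ l ∣ M := by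
  by_contra hcon
  push Not at hcon
  have hdvd : primorial X ∣ M := by
    rw [primorial_eq_prod_primesLE]
    refine Finset.prod_primes_dvd M (fun p hp => Nat.prime_iff.mp (Nat.prime_of_mem_primesLE hp))
      fun p hp => ?_
    have hp' := Nat.mem_primesLE.mp hp
    exact hcon p hp'.2 hp'.1
  have hle : (primorial X : ℝ) ≤ M := by exact_mod_cast Nat.le_of_dvd (Nat.pos_of_ne_zero hM) hdvd
  have hθ : Chebyshev.theta (X : ℝ) = Real.log (primorial X) := by
    rw [Chebyshev.theta_eq_log_primorial, Nat.floor_natCast]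
  rw [hθ] at h
  exact absurd (Real.log_le_log (by exact_mod_cast primorial_pos X) hle) (not_le.mpr h)

/-- **The least prime not dividing `M` is `≤ (1 + ε) log M + C_ε`** (for every `ε > 0`, uniformly in
`M ≥ 1`): by the prime number theorem `ϑ(x) ≥ (1 − δ) x` for large `x` (tree
`Literature.Barriers.ABC.StewartTijdeman.eventually_theta_ge`, from
`Literature.NumberTheory.LFunctions.chebyshevTheta_isEquivalent`), so `ϑ(X) > log M` already at
`X = ⌊(1 + ε) log M + C⌋` with `(1 − δ)(1 + ε) = 1`, and the sieve step applies.
[cite: MontgomeryVaughan2007, §8.1 eq. (8.3)] -/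
theorem exists_prime_not_dvd_le_log {ε : ℝ} (hε : 0 < ε) :
    ∃ C : ℝ, ∀ M : ℕ, M ≠ 0 →
      ∃ l : ℕ, l.Prime ∧ ¬ l ∣ M ∧ (l : ℝ) ≤ (1 + ε) * Real.log M + C := by
  -- `δ = ε / (1 + ε)`, so that `(1 - δ) (1 + ε) = 1`
  set δ : ℝ := ε / (1 + ε) with hδ
  have hδpos : 0 < δ := div_pos hε (by linarith)
  have h1δ : 1 - δ = 1 / (1 + ε) := by
    rw [hδ]; field_simp; ring
  have h1δpos : 0 < 1 - δ := by rw [h1δ]; positivity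
  obtain ⟨t₀, ht₀⟩ := Filter.eventually_atTop.mp
    (Literature.Barriers.ABC.StewartTijdeman.eventually_theta_ge hδpos)
  refine ⟨max t₀ 0 + 2, fun M hM => ?_⟩
  have hM1 : (1 : ℝ) ≤ M := by exact_mod_cast Nat.one_le_iff_ne_zero.mpr hM
  have hlogM : 0 ≤ Real.log M := Real.log_nonneg hM1
  set x : ℝ := (1 + ε) * Real.log M + (max t₀ 0 + 2) with hx
  have hx0 : 0 ≤ x := by
    have : 0 ≤ (1 + ε) * Real.log M := mul_nonneg (by linarith) hlogM
    have : (0 : ℝ) ≤ max t₀ 0 := le_max_right _ _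
    linarith
  set X : ℕ := ⌊x⌋₊ with hX
  have hXle : (X : ℝ) ≤ x := Nat.floor_le hx0
  have hXgt : x - 1 < X := by have := Nat.lt_floor_add_one x; linarith
  -- `X ≥ t₀`, so the prime number theorem bound applies at `X`
  have hXt₀ : t₀ ≤ (X : ℝ) := by
    have : t₀ ≤ max t₀ 0 := le_max_left _ _
    have : 0 ≤ (1 + ε) * Real.log M := mul_nonneg (by linarith) hlogM
    linarith
  have hθ : (1 - δ) * X ≤ Chebyshev.theta X := ht₀ X hXt₀
  -- `log M < ϑ(X)`
  have hkey : Real.log M < Chebyshev.theta X := by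
    have h1 : (1 - δ) * (x - 1) < (1 - δ) * X := mul_lt_mul_of_pos_left hXgt h1δpos
    have h2 : (1 - δ) * (x - 1) = Real.log M + (1 - δ) * (max t₀ 0 + 1) := by
      rw [hx, h1δ]; field_simp; ring
    have h3 : 0 ≤ (1 - δ) * (max t₀ 0 + 1) :=
      mul_nonneg h1δpos.le (by have : (0 : ℝ) ≤ max t₀ 0 := le_max_right _ _; linarith)
    linarith
  obtain ⟨l, hl, hlX, hlM⟩ := exists_prime_not_dvd_le_of_log_lt_theta hM hkey
  exact ⟨l, hl, hlM, (show (l : ℝ) ≤ X by exact_mod_cast hlX).trans hXle⟩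

/-! ## §2. Lemma (L): an admissible prime `l ≥ 11`, `l ∤ N_E`, `l ∉ L(E)`, of size `O(log N_E)` -/

/-- A prime `< 11` divides `210 = 2·3·5·7` (so a prime not dividing `210` is `≥ 11`). [folklore] -/
theorem eleven_le_of_prime_not_dvd {l : ℕ} (hl : l.Prime) (h210 : ¬ l ∣ 210) : 11 ≤ l := by
  by_contra hlt
  push Not at hlt
  have key : ∀ m : ℕ, m < 11 → m.Prime → m ∣ 210 := by decide
  exact h210 (key l hlt hl)

/-- Link to Pasten's `L(E)` BY NAME: a number dividing no `v_p(Δ_E)`, `p ∣ N_E`, is not a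
level-lowering prime (`WeierstrassCurve.mem_levelLoweringPrimes`).
[cite: PastenShimura2024, §1.4 (definition of L(E), arXiv p. 8)] -/
theorem not_mem_levelLoweringPrimes_of_forall_not_dvd (W : WeierstrassCurve ℚ) {l : ℕ}
    (h : ∀ p ∈ (W.conductorNorm ℤ).primeFactors, ¬ l ∣ (W.minimalDiscriminantNorm ℤ).factorization p) :
    l ∉ W.levelLoweringPrimes := by
  intro hl
  obtain ⟨p, hp, hlp⟩ := (W.mem_levelLoweringPrimes).mp hl
  exact h p hp (Nat.dvd_of_mem_primeFactors hlp)

/-- **Lemma (L) of card O-82 (the least admissible prime is `O(log N_E)`; PNT-strength constant).**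
Assume Pasten's Theorem 1.12 (`h`, named fact `pasten_valuationProduct_semistable`:
`∏_{p∣N_E} v_p(Δ_E) < K_ε N_E^{11/2+ε}` for semistable `E/ℚ`). Then for every `ε > 0` there is
`c₂` such that every semistable elliptic curve `W/ℚ` admits a prime `l` with `11 ≤ l`, `l ∤ N_E`,
`l ∤ v_p(Δ_E)` for all `p ∣ N_E`, and `l ≤ (13/2 + ε) log N_E + c₂`. Proof: the primes violating one
of the conditions all divide `M = 210 · N_E · ∏_{p∣N_E} v_p(Δ_E)` (Cor 16.6's divisibility
`Λ(E) ∣ ∏ v_p(Δ_E)`, tree `WeierstrassCurve.prod_levelLoweringPrimes_dvd`, in pointwise form), and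
`log M ≤ (13/2 + ε/2) log N_E + log(210·K_{ε/2})`; conclude by `exists_prime_not_dvd_le_log`.
[cite: PastenShimura2024, Cor 16.6 (arXiv §16.3, pp. 50–51)] -/
theorem exists_admissiblePrime_le_log_conductor (h : pasten_valuationProduct_semistable)
    {ε : ℝ} (hε : 0 < ε) :
    ∃ c₂ : ℝ, ∀ (W : WeierstrassCurve ℚ) [W.IsElliptic], W.IsSemistable ℤ →
      ∃ l : ℕ, l.Prime ∧ 11 ≤ l ∧ ¬ l ∣ W.conductorNorm ℤ ∧
        (∀ p ∈ (W.conductorNorm ℤ).primeFactors,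
          ¬ l ∣ (W.minimalDiscriminantNorm ℤ).factorization p) ∧
        (l : ℝ) ≤ (13 / 2 + ε) * Real.log (W.conductorNorm ℤ) + c₂ := by
  -- Pasten at `ε/2`
  obtain ⟨K, hK, hP⟩ := h (ε / 2) (half_pos hε)
  -- least-prime lemma at `ε₁ = ε / (13 + ε)`, so that `(1 + ε₁)(13/2 + ε/2) = 13/2 + ε`
  set ε₁ : ℝ := ε / (13 + ε) with hε₁
  have hε₁pos : 0 < ε₁ := div_pos hε (by linarith)
  have hmul : (1 + ε₁) * (13 / 2 + ε / 2) = 13 / 2 + ε := by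
    rw [hε₁]; field_simp; ring
  obtain ⟨C, hC⟩ := exists_prime_not_dvd_le_log hε₁pos
  set A : ℝ := Real.log 210 + Real.log K with hA
  refine ⟨(1 + ε₁) * A + C, fun W _ hss => ?_⟩
  -- the curve's numbers
  set N : ℕ := W.conductorNorm ℤ with hN
  set T : ℕ := valuationProduct W with hT
  have hNpos : 0 < N := WeierstrassCurve.conductorNorm_pos_holds W
  have hTpos : 0 < T := by
    rw [hT, valuationProduct_def]
    exact Finset.prod_pos fun p hp => W.factorization_minimalDiscriminantNorm_pos_of_mem hp
  have hNr : (0 : ℝ) < N := by exact_mod_cast hNpos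
  have hTr : (0 : ℝ) < T := by exact_mod_cast hTpos
  have hlogN : 0 ≤ Real.log N := Real.log_nonneg (by exact_mod_cast hNpos)
  -- Pasten: `T < K N^{11/2 + ε/2}`, hence `log T ≤ log K + (11/2 + ε/2) log N`
  have hPW : (T : ℝ) < K * (N : ℝ) ^ ((11 : ℝ) / 2 + ε / 2) := hP W hss
  have hlogT : Real.log T ≤ Real.log K + ((11 : ℝ) / 2 + ε / 2) * Real.log N := by
    have hpow : (0 : ℝ) < (N : ℝ) ^ ((11 : ℝ) / 2 + ε / 2) := Real.rpow_pos_of_pos hNr _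
    have := Real.log_le_log hTr hPW.le
    rwa [Real.log_mul hK.ne' hpow.ne', Real.log_rpow hNr] at this
  -- the modulus `M = 210 · N · T`
  set M : ℕ := 210 * N * T with hM
  have hM0 : M ≠ 0 := by positivity
  have hlogM : Real.log M ≤ (13 / 2 + ε / 2) * Real.log N + A := by
    have hcast : (M : ℝ) = 210 * (N : ℝ) * (T : ℝ) := by rw [hM]; push_cast; ring
    rw [hcast, Real.log_mul (by positivity) hTr.ne', Real.log_mul (by norm_num) hNr.ne', hA]
    linarith
  obtain ⟨l, hl, hlM, hlle⟩ := hC M hM0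
  -- unpack `l ∤ 210 · N · T`
  have h210 : ¬ l ∣ 210 := fun hd => hlM (dvd_mul_of_dvd_left (dvd_mul_of_dvd_left hd N) T)
  have hlN : ¬ l ∣ N := fun hd => hlM (dvd_mul_of_dvd_left (dvd_mul_of_dvd_right hd 210) T)
  have hlT : ¬ l ∣ T := fun hd => hlM (dvd_mul_of_dvd_right hd (210 * N))
  refine ⟨l, hl, eleven_le_of_prime_not_dvd hl h210, hlN, fun p hp hd => hlT ?_, ?_⟩
  · rw [hT, valuationProduct_def]
    exact hd.trans (Finset.dvd_prod_of_mem _ hp)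
  · calc (l : ℝ) ≤ (1 + ε₁) * Real.log M + C := hlle
      _ ≤ (1 + ε₁) * ((13 / 2 + ε / 2) * Real.log N + A) + C := by
          gcongr
      _ = (13 / 2 + ε) * Real.log N + ((1 + ε₁) * A + C) := by rw [← hmul]; ring

/-- **The card's residual, verbatim shape** (`logMenuAdmissible_of_pasten`, card §5, with the
Chebyshev-strength constant `c₁ = (13/2 + ε)/log 2 ≈ 9.38`): immediate from
`exists_admissiblePrime_le_log_conductor` since `log 2 ≤ 1` and `log N_E ≥ 0`.
[cite: PastenShimura2024, Cor 16.6 (arXiv §16.3, pp. 50–51)] -/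
theorem logMenuAdmissible_of_pasten (h : pasten_valuationProduct_semistable) :
    ∀ ε : ℝ, 0 < ε → ∃ c₂ : ℝ, ∀ (W : WeierstrassCurve ℚ) [W.IsElliptic], W.IsSemistable ℤ →
      ∃ l : ℕ, l.Prime ∧ 11 ≤ l ∧ ¬ l ∣ W.conductorNorm ℤ ∧
        (∀ p ∈ (W.conductorNorm ℤ).primeFactors,
          ¬ l ∣ (W.minimalDiscriminantNorm ℤ).factorization p) ∧
        (l : ℝ) ≤ (13 / 2 + ε) / Real.log 2 * Real.log (W.conductorNorm ℤ) + c₂ := by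
  intro ε hε
  obtain ⟨c₂, hc₂⟩ := exists_admissiblePrime_le_log_conductor h hε
  refine ⟨c₂, fun W _ hss => ?_⟩
  obtain ⟨l, hl, h11, hlN, hlv, hle⟩ := hc₂ W hss
  refine ⟨l, hl, h11, hlN, hlv, hle.trans ?_⟩
  have hlogN : 0 ≤ Real.log (W.conductorNorm ℤ) :=
    Real.log_nonneg (by exact_mod_cast WeierstrassCurve.conductorNorm_pos_holds W)
  have hlog2 : 0 < Real.log 2 := Real.log_pos one_lt_two
  have hlog2' : Real.log 2 ≤ 1 := by
    have := Real.log_le_sub_one_of_pos (zero_lt_two (α := ℝ)); linarith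
  have hc : (13 / 2 + ε) ≤ (13 / 2 + ε) / Real.log 2 := by
    rw [le_div_iff₀ hlog2]; nlinarith
  nlinarith

/-- The same lemma from the OTHER vendoring of Pasten's Theorem 1.12 in the tree
(`pastenShimura2024_thm_1_12`, semistable as squarefree conductor), via
`pasten_valuationProduct_semistable_iff_pastenShimura2024_thm_1_12`; and the conclusion phrased
with Pasten's set BY NAME: `l ∉ W.levelLoweringPrimes`.
[cite: PastenShimura2024, Thm 1.12 and Cor 16.6] -/
theorem exists_prime_not_mem_levelLoweringPrimes_le_log (h : pastenShimura2024_thm_1_12)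
    {ε : ℝ} (hε : 0 < ε) :
    ∃ c₂ : ℝ, ∀ (W : WeierstrassCurve ℚ) [W.IsElliptic], W.IsSemistable ℤ →
      ∃ l : ℕ, l.Prime ∧ 11 ≤ l ∧ ¬ l ∣ W.conductorNorm ℤ ∧ l ∉ W.levelLoweringPrimes ∧
        (l : ℝ) ≤ (13 / 2 + ε) * Real.log (W.conductorNorm ℤ) + c₂ := by
  obtain ⟨c₂, hc₂⟩ := exists_admissiblePrime_le_log_conductor
    (pasten_valuationProduct_semistable_iff_pastenShimura2024_thm_1_12.mpr h) hε
  refine ⟨c₂, fun W _ hss => ?_⟩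
  obtain ⟨l, hl, h11, hlN, hlv, hle⟩ := hc₂ W hss
  exact ⟨l, hl, h11, hlN, not_mem_levelLoweringPrimes_of_forall_not_dvd W hlv, hle⟩

end Summit.ABC.IUTFork.Repair.RH.LogMenuAdmissible

end
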